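import Summits.QuantumFields.BalabanUV.Beta.FP.MaxwellSymbolDerivN
import Summits.QuantumFields.BalabanUV.Beta.FP.PerfectSymbolDeriv

/-!
# `BalabanUV.Beta.FP.PerfectSymbolDerivN` — road «FP» for binder row D1, leaf H2-P, row H2-P-REG-N: `FP/PerfectSymbolDeriv` (R2, the INSTANCE) RE-TYPED
# ORDER-PARAMETRIC — the entries of the excess `maxwellMat (Re W_∞ − 1) p̂` and of the Feynman-completed perfect symbol `feynMat (Re W_∞) p̂` are `C^N` along
# every coordinate slice of the real Brillouin zone and GRADED OF ORDER 4 ∕ 2 UP TO ANY ORDER `N`: `‖∂ᵢⁿ R(s)‖ ≤ KRPN N d·‖s‖^{4−n}`, `‖∂ᵢⁿ A(s)‖ ≤ KAPN N d·‖s‖^{2−n}`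

HONEST DEPENDENCY (page 1, mandatory): continuum YM on T⁴ ⇐ BetaPertH ∧ nine spine estimates (0/9 proved); BetaPertH ⇐ (D1) ∧ (D4) ∧ CAP+tail;
G-an2-4 gates asym, D1 and NE2/3/4.  HONEST FRAMING (cell contract, verbatim): «discharging `BetaPertH` makes Bałaban's UV stability UNCONDITIONAL —
a real constructive-QFT result; it is NOT the continuum limit and NOT the Clay problem.»  THIS MODULE DISCHARGES NOTHING of the wall: it discharges the order-`N`
weight hypotheses of `FP/MaxwellSymbolDerivN` for `w := Re W_∞` from tree theorems BY NAME — W166-FLAT (`PerfectSymbol166Flat.abs_re_W166Inf_ofReal_sub_one_le`,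
order 0) and W166-HOLO (D)∕(E) (`PerfectSymbol166RealLineRe.hasDerivAt_reDW_update j`, `abs_reDW_le j`, `abs_reDW_one_le_mul_abs_apply`; d1-formalise-leaf-01 g8 —
ALREADY ORDER-PARAMETRIC, non-explicit Cauchy constants `bound166`, `delta166`).  Three explicit real CONSTANT FAMILIES (`cwPN`, `KRPN`, `KAPN`, [our object]);
no `def … : Prop`; nothing cited; 0 sorry; NOT D1, NOT BetaPertH, NOT continuum, NOT Clay.

ABSOLUTE RULE (cell charter, verbatim): «No internally-minted statement may enter as a cited fact. Every hypothesis is either kernel-proved in this package or a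
verbatim quotation of a PUBLISHED theorem with page reference. The manuscript(s) under audit are NOT citable for their own disputed steps — they are the thing
under adjudication; programme-internal (2001/route/tribunal) claims are never citable.»

WHAT (lattice dimension `d + 1`; `s ∈ BZ (d+1)`; direction `i`; `δ := delta166 (d+1)`, `B := bound166 (d+1)`; `U := Ioo (−(π+δ)) (π+δ) ∋ s i`; any `N : ℕ`).
* §1 `contDiffOn_reDW_sliceN`: every `t ↦ reDW j μ ν i (update s i t)` is `ContDiffOn ℝ N · U` (induction on `N` over the `HasDerivAt` chain of W166-HOLO (E));
  `contDiffOn_reW_sliceN` (the complex cast of `Re W_∞`); **`iteratedDeriv_ofReal_reDW_sliceN`**: `iteratedDeriv n (cast reDW j-slice) t = cast reDW (j+n)` on `U`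
  for EVERY `n` (induction), `iteratedDeriv_reW_slice_eq_reDW` (the `j = 0` case in `W_∞` dress).
* §2 **`graded_reW_sliceN`**: `‖iteratedDeriv n (t ↦ ((Re W_∞(update s i t) : ℝ) : ℂ) − 1) (s i)‖ ≤ cwPN N d · ‖s‖^{2−n}` for `n ≤ N`, with
  `cwPN N d := CW (d+1)·(d+1) + 2B∕(δ∕2)² + Σ_{j ≤ N} j!·B∕(δ∕2)^j` (`n = 0` W166-FLAT, `n = 1` evenness bound, `n ≥ 2` Cauchy).
* §3 **`graded_perfect_excess_entryN`** (`≤ KRPN N d·‖s‖^{4−n}`), **`graded_perfect_feyn_entryN`** (`≤ KAPN N d·‖s‖^{2−n}`), `n ≤ N`, every `s ∈ BZ (d+1)`, `i γ β`;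
  `contDiffOn_perfect_*_entryN` (level `N` on `U`); `hasDerivAt_perfect_*_chainN` (`j < N`, every `t ∈ U`).
Provenance: binder row G-an2-4 owner lineage gan24-p3, gen 16 (prover-b2b-balaban-gan24-p3-g16-0), 2026-08-20; row H2-P-REG-N (owner b2b-balaban-beta-d1-p3);
consumers H2-P-CHAIN-N (beta-d1-formalise-leaf-01 g8), H2-P-INV-N (`FP/InverseSymbolDerivN` p237087), (K2)∕(K3) of H2-P-KER-ASM (orders 4, 5).
-/

noncomputable section

namespace Summit.QuantumFields.BalabanUV.Beta.FP.PerfectSymbolDerivN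

open Complex Finset Set Filter
open scoped BigOperators ComplexConjugate Topology
open Literature.MathematicalPhysics.QuantumFieldTheory.Balaban1983to89
open B4Strip (ofRealVec S1r)
open B4ContourShift (BZ)
open B5Prop11Fiber (d1Sym)
open Summit.QuantumFields.BalabanUV.Beta.FP.PerfectSymbol166 (W166Inf)
open Summit.QuantumFields.BalabanUV.Beta.FP.PerfectPropagatorSymbol (curlRow maxwellMat feynMat)
open Summit.QuantumFields.BalabanUV.Beta.FP.PerfectSymbol166Flat (CW CW_nonneg abs_re_W166Inf_ofReal_sub_one_le)
open Summit.QuantumFields.BalabanUV.Beta.FP.PerfectSymbol166StripReg (delta166 delta166_pos bound166 bound166_nonneg)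
open Summit.QuantumFields.BalabanUV.Beta.FP.PerfectSymbol166RealLineRe (reDW reDW_zero hasDerivAt_reDW_update abs_reDW_le abs_reDW_one_le_mul_abs_apply)
open Summit.QuantumFields.BalabanUV.Beta.FP.GradedIteratedDerivN
open Summit.QuantumFields.BalabanUV.Beta.FP.MaxwellSymbolDerivN
open Summit.QuantumFields.BalabanUV.Beta.FP.PerfectSymbolDeriv (norm_le_pi_of_mem_BZ apply_mem_Ioo abs_lt_of_mem_Ioo differentiableOn_reDW_slice
  deriv_reDW_slice_eqOn hasDerivAt_ofReal_reDW_slice sum_S1r_le_mul_norm_sq)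

variable {d : ℕ}

/-! ## §1 The real slices of the continuum multiplier are `C^N` on the open interval, for every `N` -/

/-- [folklore] **EVERY MEMBER OF THE `reDW` CHAIN IS `C^N` ALONG THE SLICE ON THE OPEN INTERVAL, FOR EVERY `N`** (induction on `N` through
`contDiffOn_succ_iff_deriv_of_isOpen` over the `HasDerivAt` chain `reDW j → reDW (j+1)` of W166-HOLO (E)). -/
theorem contDiffOn_reDW_sliceN (N j : ℕ) (μ ν i : Fin (d + 1)) {s : Fin (d + 1) → ℝ} (hs : s ∈ BZ (d + 1)) :
    ContDiffOn ℝ N (fun u : ℝ => reDW j μ ν i (Function.update s i u)) (Ioo (-(Real.pi + delta166 (d + 1))) (Real.pi + delta166 (d + 1))) := by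
  have hU : IsOpen (Ioo (-(Real.pi + delta166 (d + 1))) (Real.pi + delta166 (d + 1))) := isOpen_Ioo
  induction N generalizing j with
  | zero => exact_mod_cast contDiffOn_zero.mpr (differentiableOn_reDW_slice j μ ν i hs).continuousOn
  | succ N ih =>
    have h : ContDiffOn ℝ ((N : WithTop ℕ∞) + 1) (fun u : ℝ => reDW j μ ν i (Function.update s i u))
        (Ioo (-(Real.pi + delta166 (d + 1))) (Real.pi + delta166 (d + 1))) := by
      refine (contDiffOn_succ_iff_deriv_of_isOpen hU).mpr ⟨differentiableOn_reDW_slice j μ ν i hs, ?_, ?_⟩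
      · intro hω; exact absurd hω (by exact_mod_cast WithTop.natCast_ne_top N)
      · exact (ih (j + 1)).congr fun t ht => deriv_reDW_slice_eqOn j μ ν i hs ht
    exact_mod_cast h

/-- [folklore] the complex cast of the real slice of `W_∞` is `ContDiffOn ℝ N` on the open interval, for every `N`. -/
theorem contDiffOn_reW_sliceN (N : ℕ) (μ ν i : Fin (d + 1)) {s : Fin (d + 1) → ℝ} (hs : s ∈ BZ (d + 1)) :
    ContDiffOn ℝ N (fun u : ℝ => (((W166Inf μ ν (ofRealVec (Function.update s i u))).re : ℝ) : ℂ))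
      (Ioo (-(Real.pi + delta166 (d + 1))) (Real.pi + delta166 (d + 1))) := by
  have h := Complex.ofRealCLM.contDiff.comp_contDiffOn (contDiffOn_reDW_sliceN N 0 μ ν i hs)
  refine h.congr fun u _ => ?_
  simp [reDW_zero]

/-- [folklore] **THE REAL-PARAMETER DERIVATIVES OF THE CAST SLICES ARE `reDW`, TO EVERY ORDER**: for `t` in the open interval and every `n j`,
`iteratedDeriv n (u ↦ ((reDW j ⋯ (update s i u) : ℝ) : ℂ)) t = ((reDW (j + n) ⋯ (update s i t) : ℝ) : ℂ)` (uniqueness of derivatives near `t`, induction on `n`). -/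
theorem iteratedDeriv_ofReal_reDW_sliceN (μ ν i : Fin (d + 1)) {s : Fin (d + 1) → ℝ} (hs : s ∈ BZ (d + 1)) :
    ∀ n j : ℕ, ∀ t ∈ Ioo (-(Real.pi + delta166 (d + 1))) (Real.pi + delta166 (d + 1)),
      iteratedDeriv n (fun u : ℝ => ((reDW j μ ν i (Function.update s i u) : ℝ) : ℂ)) t = ((reDW (j + n) μ ν i (Function.update s i t) : ℝ) : ℂ) := by
  have hU : IsOpen (Ioo (-(Real.pi + delta166 (d + 1))) (Real.pi + delta166 (d + 1))) := isOpen_Ioo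
  have step : ∀ (k j : ℕ), ∀ t ∈ Ioo (-(Real.pi + delta166 (d + 1))) (Real.pi + delta166 (d + 1)),
      iteratedDeriv (k + 1) (fun u : ℝ => ((reDW j μ ν i (Function.update s i u) : ℝ) : ℂ)) t
        = iteratedDeriv k (fun u : ℝ => ((reDW (j + 1) μ ν i (Function.update s i u) : ℝ) : ℂ)) t := by
    intro k j t ht
    rw [iteratedDeriv_succ']
    refine Filter.EventuallyEq.iteratedDeriv_eq k ?_
    filter_upwards [hU.mem_nhds ht] with u hu
    exact (hasDerivAt_ofReal_reDW_slice j μ ν i hs hu).deriv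
  intro n
  induction n with
  | zero => intro j t _; simp
  | succ k ih =>
    intro j t ht
    rw [step k j t ht, ih (j + 1) t ht, show j + 1 + k = j + (k + 1) by omega]

/-- [folklore] the same in `W_∞` dress: `iteratedDeriv n (u ↦ ((Re W_∞(update s i u) : ℝ) : ℂ)) t = ((reDW n ⋯ (update s i t) : ℝ) : ℂ)` on the open interval, every `n`. -/
theorem iteratedDeriv_reW_slice_eq_reDW (μ ν i : Fin (d + 1)) {s : Fin (d + 1) → ℝ} (hs : s ∈ BZ (d + 1)) (n : ℕ) {t : ℝ}
    (ht : t ∈ Ioo (-(Real.pi + delta166 (d + 1))) (Real.pi + delta166 (d + 1))) :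
    iteratedDeriv n (fun u : ℝ => (((W166Inf μ ν (ofRealVec (Function.update s i u))).re : ℝ) : ℂ)) t = ((reDW n μ ν i (Function.update s i t) : ℝ) : ℂ) := by
  have ew : (fun u : ℝ => (((W166Inf μ ν (ofRealVec (Function.update s i u))).re : ℝ) : ℂ)) = fun u : ℝ => ((reDW 0 μ ν i (Function.update s i u) : ℝ) : ℂ) := by
    funext u; rw [reDW_zero]
  rw [ew, iteratedDeriv_ofReal_reDW_sliceN μ ν i hs n 0 t ht, Nat.zero_add]

/-! ## §2 The graded weight hypothesis for `Re W_∞`, discharged to every order -/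

/-- [our object] THE GRADED CONSTANT OF THE PERFECT WEIGHT TO ORDER `N`: `cwPN N d := CW (d+1)·(d+1) + 2B∕(δ∕2)² + Σ_{j ≤ N} j!·B∕(δ∕2)^j`
(`B = bound166 (d+1)`, `δ = delta166 (d+1)`; non-explicit through the Cauchy constants of W166-HOLO). -/
def cwPN (N d : ℕ) : ℝ :=
  CW (d + 1) * ((d : ℝ) + 1) + 2 * bound166 (d + 1) / (delta166 (d + 1) / 2) ^ 2
    + ∑ j ∈ Finset.range (N + 1), (j.factorial : ℝ) * bound166 (d + 1) / (delta166 (d + 1) / 2) ^ j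

/-- [folklore] `0 ≤ cwPN N d`. -/
theorem cwPN_nonneg (N d : ℕ) : 0 ≤ cwPN N d := by
  unfold cwPN
  have h1 := CW_nonneg (d + 1); have h2 := bound166_nonneg (d + 1); have h3 := delta166_pos (d + 1)
  have h4 : 0 ≤ ∑ j ∈ Finset.range (N + 1), (j.factorial : ℝ) * bound166 (d + 1) / (delta166 (d + 1) / 2) ^ j :=
    Finset.sum_nonneg fun j _ => by positivity
  positivity

/-- [folklore] trichotomy of a natural number: `0`, `1`, or `k + 2`. -/
theorem nat_zero_one_or_add_two (n : ℕ) : n = 0 ∨ n = 1 ∨ ∃ k, n = k + 2 := by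
  rcases n with _ | _ | k
  · exact Or.inl rfl
  · exact Or.inr (Or.inl rfl)
  · exact Or.inr (Or.inr ⟨k, rfl⟩)

/-- [our object] **THE GRADED WEIGHT HYPOTHESIS DISCHARGED FOR `Re W_∞` TO EVERY ORDER**: for `s ∈ BZ (d+1)` and every `μ ν i`,
`‖iteratedDeriv n (u ↦ ((Re W_∞(μ,ν; update s i u) : ℝ) : ℂ) − 1) (s i)‖ ≤ cwPN N d · ‖s‖^{2−n}` for `n ≤ N`. -/
theorem graded_reW_sliceN (N : ℕ) (μ ν i : Fin (d + 1)) {s : Fin (d + 1) → ℝ} (hs : s ∈ BZ (d + 1)) :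
    ∀ n ≤ N, ‖iteratedDeriv n (fun u : ℝ => (((W166Inf μ ν (ofRealVec (Function.update s i u))).re : ℝ) : ℂ) - 1) (s i)‖ ≤ cwPN N d * ‖s‖ ^ (2 - n) := by
  have hB := bound166_nonneg (d + 1); have hδ := delta166_pos (d + 1); have hCW := CW_nonneg (d + 1)
  have hsi := apply_mem_Ioo hs i
  set c0 : ℝ := CW (d + 1) * ((d : ℝ) + 1) with hc0
  set c1 : ℝ := 2 * bound166 (d + 1) / (delta166 (d + 1) / 2) ^ 2 with hc1
  set cS : ℝ := ∑ j ∈ Finset.range (N + 1), (j.factorial : ℝ) * bound166 (d + 1) / (delta166 (d + 1) / 2) ^ j with hcS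
  have h0c : 0 ≤ c0 := by positivity
  have h1c : 0 ≤ c1 := by positivity
  have hSc : 0 ≤ cS := Finset.sum_nonneg fun j _ => by positivity
  have ecw : cwPN N d = c0 + c1 + cS := rfl
  -- derivatives of order ≥ 1 of `slice − 1` are those of the slice
  have hsub : ∀ k : ℕ, iteratedDeriv (k + 1) (fun u : ℝ => (((W166Inf μ ν (ofRealVec (Function.update s i u))).re : ℝ) : ℂ) - 1)
      = iteratedDeriv (k + 1) (fun u : ℝ => (((W166Inf μ ν (ofRealVec (Function.update s i u))).re : ℝ) : ℂ)) := by
    intro k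
    rw [iteratedDeriv_succ', iteratedDeriv_succ']
    congr 1
    funext x
    exact deriv_sub_const 1
  have hsi' : |s i| ≤ ‖s‖ := by have h := norm_le_pi_norm s i; rwa [Real.norm_eq_abs] at h
  intro n hn
  rcases nat_zero_one_or_add_two n with rfl | rfl | ⟨k, rfl⟩
  · -- order 0: W166-FLAT
    rw [iteratedDeriv_zero, Function.update_eq_self, ← Complex.ofReal_one, ← Complex.ofReal_sub, Complex.norm_real, Real.norm_eq_abs]
    calc |(W166Inf μ ν (ofRealVec s)).re - 1| ≤ CW (d + 1) * ∑ a, S1r (s a) := abs_re_W166Inf_ofReal_sub_one_le μ ν hs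
      _ ≤ CW (d + 1) * (((d : ℝ) + 1) * ‖s‖ ^ 2) := mul_le_mul_of_nonneg_left (sum_S1r_le_mul_norm_sq s) hCW
      _ = c0 * ‖s‖ ^ (2 - 0) := by rw [hc0]; ring
      _ ≤ cwPN N d * ‖s‖ ^ (2 - 0) := mul_le_mul_of_nonneg_right (by rw [ecw]; linarith) (pow_nonneg (norm_nonneg _) _)
  · -- order 1: evenness + Cauchy (W166-HOLO)
    rw [hsub 0, iteratedDeriv_reW_slice_eq_reDW μ ν i hs 1 hsi, Function.update_eq_self, Complex.norm_real, Real.norm_eq_abs]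
    calc |reDW 1 μ ν i s| ≤ c1 * |s i| := abs_reDW_one_le_mul_abs_apply μ ν i hs
      _ ≤ c1 * ‖s‖ := mul_le_mul_of_nonneg_left hsi' h1c
      _ ≤ cwPN N d * ‖s‖ ^ (2 - 1) := by
          rw [show (2 - 1 : ℕ) = 1 from rfl, pow_one]
          exact mul_le_mul_of_nonneg_right (by rw [ecw]; linarith) (norm_nonneg _)
  · -- order k + 2 ≥ 2: Cauchy, the (k+2)-nd term of the sum
    rw [hsub (k + 1), iteratedDeriv_reW_slice_eq_reDW μ ν i hs (k + 2) hsi, Function.update_eq_self, Complex.norm_real, Real.norm_eq_abs,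
      show (2 - (k + 2) : ℕ) = 0 by omega, pow_zero, mul_one]
    have hmem : k + 2 ∈ Finset.range (N + 1) := Finset.mem_range.mpr (Nat.lt_succ_of_le hn)
    have hle : ((k + 2).factorial : ℝ) * bound166 (d + 1) / (delta166 (d + 1) / 2) ^ (k + 2) ≤ cS :=
      Finset.single_le_sum (f := fun j => (j.factorial : ℝ) * bound166 (d + 1) / (delta166 (d + 1) / 2) ^ j) (fun j _ => by positivity) hmem
    calc |reDW (k + 2) μ ν i s| ≤ ((k + 2).factorial : ℝ) * bound166 (d + 1) / (delta166 (d + 1) / 2) ^ (k + 2) := abs_reDW_le (k + 2) μ ν i hs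
      _ ≤ cS := hle
      _ ≤ cwPN N d := by rw [ecw]; linarith

/-! ## §3 The perfect symbol to order `N`: excess of ORDER 4, Feynman completion of ORDER 2 -/

/-- [our object] `KRPN N d := 2·4^N·(d+1)²·(π+1)⁶·cwPN N d` — the order-4 constant of the perfect excess entry to order `N`. -/
def KRPN (N d : ℕ) : ℝ := 2 * 4 ^ N * ((d : ℝ) + 1) ^ 2 * (Real.pi + 1) ^ 6 * cwPN N d

/-- [our object] `KAPN N d := 2·4^N·(d+1)²·(π+1)⁴·((π+1)²·cwPN N d + 1) + 2^N·(π+1)²` — the order-2 constant of the perfect Feynman entry to order `N`. -/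
def KAPN (N d : ℕ) : ℝ := 2 * 4 ^ N * ((d : ℝ) + 1) ^ 2 * (Real.pi + 1) ^ 4 * ((Real.pi + 1) ^ 2 * cwPN N d + 1) + 2 ^ N * (Real.pi + 1) ^ 2

/-- [our object] **THE EXCESS PERFECT MAXWELL ENTRY ALONG A SLICE IS `C^N` ON THE OPEN INTERVAL.** -/
theorem contDiffOn_perfect_excess_entryN (N : ℕ) {s : Fin (d + 1) → ℝ} (hs : s ∈ BZ (d + 1)) (i γ β : Fin (d + 1)) :
    ContDiffOn ℝ N (fun t : ℝ => maxwellMat (fun μ ν => (W166Inf μ ν (ofRealVec (Function.update s i t))).re - 1)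
      (d1Sym (Function.update s i t)) γ β) (Ioo (-(Real.pi + delta166 (d + 1))) (Real.pi + delta166 (d + 1))) :=
  contDiffOn_excess_entryN (fun μ ν s => (W166Inf μ ν (ofRealVec s)).re) s i (fun μ ν => contDiffOn_reW_sliceN N μ ν i hs) γ β

/-- [our object] **THE PERFECT FEYNMAN ENTRY ALONG A SLICE IS `C^N` ON THE OPEN INTERVAL.** -/
theorem contDiffOn_perfect_feyn_entryN (N : ℕ) {s : Fin (d + 1) → ℝ} (hs : s ∈ BZ (d + 1)) (i γ β : Fin (d + 1)) :
    ContDiffOn ℝ N (fun t : ℝ => feynMat (fun μ ν => (W166Inf μ ν (ofRealVec (Function.update s i t))).re)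
      (d1Sym (Function.update s i t)) γ β) (Ioo (-(Real.pi + delta166 (d + 1))) (Real.pi + delta166 (d + 1))) :=
  contDiffOn_feyn_entryN (fun μ ν s => (W166Inf μ ν (ofRealVec s)).re) s i (fun μ ν => contDiffOn_reW_sliceN N μ ν i hs) γ β

/-- [our object] **THE EXCESS PERFECT MAXWELL ENTRY IS GRADED OF ORDER 4 TO EVERY ORDER**: for every `N`, `s ∈ BZ (d+1)` and `i γ β`,
`‖∂ᵢⁿ [maxwellMat (Re W_∞ − 1) (p̂)]_{γβ} (s)‖ ≤ KRPN N d · ‖s‖^{4−n}`, `n ≤ N`. -/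
theorem graded_perfect_excess_entryN (N : ℕ) {s : Fin (d + 1) → ℝ} (hs : s ∈ BZ (d + 1)) (i γ β : Fin (d + 1)) :
    ∀ n ≤ N, ‖iteratedDeriv n (fun t : ℝ => maxwellMat (fun μ ν => (W166Inf μ ν (ofRealVec (Function.update s i t))).re - 1)
      (d1Sym (Function.update s i t)) γ β) (s i)‖ ≤ KRPN N d * ‖s‖ ^ (4 - n) := by
  have hM : (1 : ℝ) ≤ Real.pi + 1 := by linarith [Real.pi_pos]
  have hsM : ‖s‖ ≤ Real.pi + 1 := (norm_le_pi_of_mem_BZ hs).trans (by linarith)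
  have h := graded_excess_entry_onN (fun μ ν s => (W166Inf μ ν (ofRealVec s)).re) s i isOpen_Ioo (apply_mem_Ioo hs i)
    (fun μ ν => contDiffOn_reW_sliceN N μ ν i hs) (cwPN_nonneg N d) (fun μ ν => graded_reW_sliceN N μ ν i hs) hsM hM γ β
  intro n hn
  refine (h n hn).trans (le_of_eq ?_)
  unfold KRPN; push_cast; ring

/-- [our object] **THE PERFECT FEYNMAN ENTRY IS GRADED OF ORDER 2 TO EVERY ORDER**: for every `N`, `s ∈ BZ (d+1)` and `i γ β`,
`‖∂ᵢⁿ [feynMat (Re W_∞) (p̂)]_{γβ} (s)‖ ≤ KAPN N d · ‖s‖^{2−n}`, `n ≤ N`. -/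
theorem graded_perfect_feyn_entryN (N : ℕ) {s : Fin (d + 1) → ℝ} (hs : s ∈ BZ (d + 1)) (i γ β : Fin (d + 1)) :
    ∀ n ≤ N, ‖iteratedDeriv n (fun t : ℝ => feynMat (fun μ ν => (W166Inf μ ν (ofRealVec (Function.update s i t))).re)
      (d1Sym (Function.update s i t)) γ β) (s i)‖ ≤ KAPN N d * ‖s‖ ^ (2 - n) := by
  have hM : (1 : ℝ) ≤ Real.pi + 1 := by linarith [Real.pi_pos]
  have hsM : ‖s‖ ≤ Real.pi + 1 := (norm_le_pi_of_mem_BZ hs).trans (by linarith)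
  have h := graded_feyn_entry_onN (fun μ ν s => (W166Inf μ ν (ofRealVec s)).re) s i isOpen_Ioo (apply_mem_Ioo hs i)
    (fun μ ν => contDiffOn_reW_sliceN N μ ν i hs) (cwPN_nonneg N d) (fun μ ν => graded_reW_sliceN N μ ν i hs) hsM hM γ β
  intro n hn
  refine (h n hn).trans (le_of_eq ?_)
  unfold KAPN; push_cast; ring

/-- [our object] **THE CHAIN FOR THE EXCESS ENTRY TO ORDER `N`** on the open interval (`j < N`, every `t`). -/
theorem hasDerivAt_perfect_excess_chainN (N : ℕ) {s : Fin (d + 1) → ℝ} (hs : s ∈ BZ (d + 1)) (i γ β : Fin (d + 1)) {j : ℕ} (hj : j < N)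
    {t : ℝ} (ht : t ∈ Ioo (-(Real.pi + delta166 (d + 1))) (Real.pi + delta166 (d + 1))) :
    HasDerivAt (iteratedDeriv j (fun u : ℝ => maxwellMat (fun μ ν => (W166Inf μ ν (ofRealVec (Function.update s i u))).re - 1)
        (d1Sym (Function.update s i u)) γ β))
      (iteratedDeriv (j + 1) (fun u : ℝ => maxwellMat (fun μ ν => (W166Inf μ ν (ofRealVec (Function.update s i u))).re - 1)
        (d1Sym (Function.update s i u)) γ β) t) t :=
  hasDerivAt_iteratedDeriv_onN isOpen_Ioo (contDiffOn_perfect_excess_entryN N hs i γ β) hj ht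

/-- [our object] **THE CHAIN FOR THE FEYNMAN ENTRY TO ORDER `N`** on the open interval (`j < N`, every `t`). -/
theorem hasDerivAt_perfect_feyn_chainN (N : ℕ) {s : Fin (d + 1) → ℝ} (hs : s ∈ BZ (d + 1)) (i γ β : Fin (d + 1)) {j : ℕ} (hj : j < N)
    {t : ℝ} (ht : t ∈ Ioo (-(Real.pi + delta166 (d + 1))) (Real.pi + delta166 (d + 1))) :
    HasDerivAt (iteratedDeriv j (fun u : ℝ => feynMat (fun μ ν => (W166Inf μ ν (ofRealVec (Function.update s i u))).re)
        (d1Sym (Function.update s i u)) γ β))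
      (iteratedDeriv (j + 1) (fun u : ℝ => feynMat (fun μ ν => (W166Inf μ ν (ofRealVec (Function.update s i u))).re)
        (d1Sym (Function.update s i u)) γ β) t) t :=
  hasDerivAt_iteratedDeriv_onN isOpen_Ioo (contDiffOn_perfect_feyn_entryN N hs i γ β) hj ht

/-- [our object] BRIDGE ∕ NON-VACUITY OF THE ORDER: the graded bound at orders `4` and `5` for the excess entry (what (K2)∕(K3) consume). -/
example {s : Fin (d + 1) → ℝ} (hs : s ∈ BZ (d + 1)) (i γ β : Fin (d + 1)) :
    ‖iteratedDeriv 5 (fun t : ℝ => maxwellMat (fun μ ν => (W166Inf μ ν (ofRealVec (Function.update s i t))).re - 1)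
      (d1Sym (Function.update s i t)) γ β) (s i)‖ ≤ KRPN 5 d * ‖s‖ ^ (4 - 5)
    ∧ ‖iteratedDeriv 4 (fun t : ℝ => maxwellMat (fun μ ν => (W166Inf μ ν (ofRealVec (Function.update s i t))).re - 1)
      (d1Sym (Function.update s i t)) γ β) (s i)‖ ≤ KRPN 5 d * ‖s‖ ^ (4 - 4) :=
  ⟨graded_perfect_excess_entryN 5 hs i γ β 5 le_rfl, graded_perfect_excess_entryN 5 hs i γ β 4 (by norm_num)⟩

end Summit.QuantumFields.BalabanUV.Beta.FP.PerfectSymbolDerivN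

end
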